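import Summits.HubbardSuperconductivity.HubbardSuperconductivity.Theorems.BirGroundStateAverageLRO.Negative.MomentumSmearingTransfer
import Summits.HubbardSuperconductivity.HubbardSuperconductivity.Theorems.BalabanIRBirGroundStateAverageLROBounds
import Literature.MathematicalPhysics.QuantumLattice.PairFieldMomentumSmearing

/-!
# Crux `BirGroundStateAverageLRO` (item `stmt-HubbardSuperconductivity-2079`): the Fermi-surface corner — no ground-state-average pair order without a smeared momentum distribution

Seventh corner of the regime map of the crux (`Theses.BalabanIR.BirGroundStateAverageLRO`, route
BalabanIR, target / rank 0: on a window `0 < U₁ < U < U₂`, eventually in even `L`,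
`c·L⁴·Re tr P ≤ Re tr (P Δ_d† Δ_d)` for the projection `P` onto the ground eigenspace of
`hubbardTorus 2 L 1 U` in the sector `(N, S^z = 0)`, `N = 2⌊(1-δ)L²/2⌋`), and the only one about a
ONE-BODY observable: the ground-state-AVERAGED momentum distribution
`x̄_k = Re tr (P n_{k↑}) / Re tr P ∈ [0,1]` and its total smearing `S̄ = Σ_k x̄_k (1 - x̄_k)`
(`S̄ = o(L²)` means: a sharp Fermi surface up to `o(L²)` Bloch modes).

(The Jensen transfer of the non-linear state-wise bound to subspace averages —
`re_trace_projMatrix_mul_le_smearingAverage`, `smearing_ge_of_sqrt_bound` — is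
`Negative/MomentumSmearingTransfer.lean`.)

* `re_trace_groundProj_mul_pairField_le_smearing` (the crux's `let` vocabulary, any `δ`, `U`, `L`):
  **`Re tr (P Δ_d† Δ_d) ≤ Re tr P · (32 L² + 32 L³ √S̄)`** from the state-wise bound of
  `PairFieldMomentumSmearing.lean`;
* `avgBound_smearing_ge` — **if the crux's inequality holds at ONE datum `(δ, U, c, L)` with
  `c L² ≥ 64`, then `S̄ ≥ c² L²/4096`**; `exists_groundState_smearing_ge` — the same for SOME
  normalised sector ground state (pointwise distribution);
* `birGroundStateAverageLRO_witness_smearing` (registered one-line stub `momentumSmearingWitness`,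
  `--supports stmt-HubbardSuperconductivity-2079`) — **every witness `(δ, U₁, U₂, c)` of the crux
  has, at every coupling of its window and eventually in even `L`, a ground-state-averaged momentum
  distribution with `Σ_k x̄_k(1 - x̄_k) ≥ c² L²/4096`**: a macroscopic number of partially occupied Bloch
  modes (the BCS `u_k v_k` smearing as a NECESSARY condition); `birGroundStateAverageLRO_smearing` —
  the conditional reading on the crux.

So a witness window is disjoint from any regime in which the sector ground states of the Hubbard
torus have (on average over the ground eigenspace) an asymptotically SHARP momentum distribution —
e.g. any putative `T = 0` Landau–Fermi-liquid window with `o(L²)` smeared modes; compare the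
finite-temperature Fermi-liquid constructions for `d = 2` Hubbard-type models (Benfatto–Giuliani–
Mastropietro, Ann. Henri Poincaré 7 (2006) 809, Theorem 1.1, above the exponentially small BCS
scale), which control exactly this observable.

Sources: J. Bardeen, L. N. Cooper, J. R. Schrieffer, Phys. Rev. 108 (1957) 1175, §II; C. N. Yang,
Rev. Mod. Phys. 34 (1962) 694, §3; H. Tasaki (2020) §2.1, App. A.2 (ground-state averages).
Folklore finite-dimensional statements; no definition and no named fact is introduced; nothing here
asserts a Theses decl.
-/

noncomputable section

namespace Summit.HubbardSuperconductivity.HubbardSuperconductivity.Theorems.BirGroundStateAverageLRO.Negative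

set_option linter.dupNamespace false

open Matrix Finset Filter
open Literature.Probability.LatticeModels Literature.MathematicalPhysics.QuantumLattice
open Literature.Computability.AlgebraicComplexity
open Summit.HubbardSuperconductivity.HubbardSuperconductivity.Theorems
open Summit.HubbardSuperconductivity.HubbardSuperconductivity.Theses.BalabanIR
open scoped ComplexOrder

/-! ### §3 The crux format -/

section CruxFormat

variable (L : ℕ) [NeZero L]

/-- **Smearing ceiling on the sector ground-state average, any Hamiltonian.** For ANY matrix `H` on
the Fock space of the torus of side `L`, any sector `(N, M)` and eigenvalue `e`, the projection `P`
onto `szSector N M ⊓ ker (H - e)` satisfies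
`Re tr (P Δ_d† Δ_d) ≤ Re tr P · (32 L² + 32 L³ √(Σ_k x̄_k(1 - x̄_k)))`,
`x̄_k = Re tr (P n_{k↑})/Re tr P` (average over the subspace of
`re_expect_pairField_dWave_le_smearing`). Bardeen–Cooper–Schrieffer (1957) §II; Tasaki (2020) §2.1.
[folklore] -/
theorem re_trace_sectorGroundProj_mul_pairField_dWave_le_smearing
    (H : Matrix (Finset (Orb (FermionTorus 2 L))) (Finset (Orb (FermionTorus 2 L))) ℂ) (N : ℕ)
    (M : ℝ) (e : ℂ) :
    (projMatrix ((szSector N M ⊓ Module.End.eigenspace (Matrix.toLin' H) e).map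
        (Fock.toEuclidean (ι := Orb (FermionTorus 2 L)) :
          Fock (Orb (FermionTorus 2 L)) →ₗ[ℂ]
            EuclideanSpace ℂ (Finset (Orb (FermionTorus 2 L))))) *
        ((pairField dWaveFormFactor L)ᴴ * pairField dWaveFormFactor L)).trace.re ≤
      (projMatrix ((szSector N M ⊓ Module.End.eigenspace (Matrix.toLin' H) e).map
        (Fock.toEuclidean (ι := Orb (FermionTorus 2 L)) :
          Fock (Orb (FermionTorus 2 L)) →ₗ[ℂ]
            EuclideanSpace ℂ (Finset (Orb (FermionTorus 2 L)))))).trace.re *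
        (32 * (L : ℝ) ^ 2 + 32 * (L : ℝ) ^ 3 * Real.sqrt (∑ k : TorusSite 2 L,
          (projMatrix ((szSector N M ⊓ Module.End.eigenspace (Matrix.toLin' H) e).map
              (Fock.toEuclidean (ι := Orb (FermionTorus 2 L)) :
                Fock (Orb (FermionTorus 2 L)) →ₗ[ℂ]
                  EuclideanSpace ℂ (Finset (Orb (FermionTorus 2 L))))) *
              momentumNumber k 0).trace.re /
            (projMatrix ((szSector N M ⊓ Module.End.eigenspace (Matrix.toLin' H) e).map
              (Fock.toEuclidean (ι := Orb (FermionTorus 2 L)) :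
                Fock (Orb (FermionTorus 2 L)) →ₗ[ℂ]
                  EuclideanSpace ℂ (Finset (Orb (FermionTorus 2 L)))))).trace.re *
          (1 - (projMatrix ((szSector N M ⊓ Module.End.eigenspace (Matrix.toLin' H) e).map
              (Fock.toEuclidean (ι := Orb (FermionTorus 2 L)) :
                Fock (Orb (FermionTorus 2 L)) →ₗ[ℂ]
                  EuclideanSpace ℂ (Finset (Orb (FermionTorus 2 L))))) *
              momentumNumber k 0).trace.re /
            (projMatrix ((szSector N M ⊓ Module.End.eigenspace (Matrix.toLin' H) e).map
              (Fock.toEuclidean (ι := Orb (FermionTorus 2 L)) :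
                Fock (Orb (FermionTorus 2 L)) →ₗ[ℂ]
                  EuclideanSpace ℂ (Finset (Orb (FermionTorus 2 L)))))).trace.re))) := by
  rw [map_toEuclidean_eq]
  refine re_trace_projMatrix_mul_le_smearingAverage _ _ (fun k : TorusSite 2 L => momentumNumber k 0)
    (by positivity) (fun v _ hv1 k => ?_) (fun v _ hv1 => re_expect_pairField_dWave_le_smearing v hv1)
  have hx := re_expect_momentumNumber_mem_Icc k 0 v
  rw [hv1, Complex.one_re] at hx
  exact hx

/-- **Smearing ceiling in the crux's vocabulary, every coupling.** For every `δ`, `U`, `L`, the crux's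
data satisfy `Re tr (P Δ_d† Δ_d) ≤ Re tr P · (32 L² + 32 L³ √S̄)`,
`S̄ = Σ_k x̄_k (1 - x̄_k)`, `x̄_k = Re tr (P n_{k↑})/Re tr P`. The inner `let`s are the crux's.
Bardeen–Cooper–Schrieffer (1957) §II. [folklore] -/
theorem re_trace_groundProj_mul_pairField_le_smearing (δ U : ℝ) :
    let N : ℕ := 2 * ⌊(1 - δ) * (L : ℝ) ^ 2 / 2⌋₊
    let H := hubbardTorus 2 L 1 U
    let S := szSector (Λ := FermionTorus 2 L) N 0
    let E₀ := S ⊓ Module.End.eigenspace (Matrix.toLin' H) ((H.minEnergyOn S : ℝ) : ℂ)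
    let P := projMatrix (E₀.map (Fock.toEuclidean (ι := Orb (FermionTorus 2 L)) :
      Fock (Orb (FermionTorus 2 L)) →ₗ[ℂ] EuclideanSpace ℂ (Finset (Orb (FermionTorus 2 L)))))
    (P * ((pairField dWaveFormFactor L)ᴴ * pairField dWaveFormFactor L)).trace.re ≤
      P.trace.re * (32 * (L : ℝ) ^ 2 + 32 * (L : ℝ) ^ 3 * Real.sqrt (∑ k : TorusSite 2 L,
        (P * momentumNumber k 0).trace.re / P.trace.re *
          (1 - (P * momentumNumber k 0).trace.re / P.trace.re))) := by
  intro N H S E₀ P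
  exact re_trace_sectorGroundProj_mul_pairField_dWave_le_smearing L H _ _ _

/-- **The average bound forces a smeared momentum distribution.** If the crux's ground-state-average
bound `c·L⁴·Re tr P ≤ Re tr (P Δ_d† Δ_d)` holds at ONE datum `(δ, U, c, L)` with `δ ≥ -1` and
`c L² ≥ 64`, then the ground-state-averaged momentum distribution `x̄_k = Re tr (P n_{k↑})/Re tr P`
has total smearing `Σ_k x̄_k (1 - x̄_k) ≥ c² L²/4096`: at least `c² L²/1024` Bloch modes are, on
average over the ground eigenspace, partially occupied. Bardeen–Cooper–Schrieffer (1957) §II (the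
pairing amplitude `u_k v_k`); this is its necessity, quantified. [folklore] -/
theorem avgBound_smearing_ge {δ U c : ℝ} (hδ : -1 ≤ δ) (h64 : 64 ≤ c * (L : ℝ) ^ 2)
    (h : let N : ℕ := 2 * ⌊(1 - δ) * (L : ℝ) ^ 2 / 2⌋₊
      let H := hubbardTorus 2 L 1 U
      let S := szSector (Λ := FermionTorus 2 L) N 0
      let E₀ := S ⊓ Module.End.eigenspace (Matrix.toLin' H) ((H.minEnergyOn S : ℝ) : ℂ)
      let P := projMatrix (E₀.map (Fock.toEuclidean (ι := Orb (FermionTorus 2 L)) :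
        Fock (Orb (FermionTorus 2 L)) →ₗ[ℂ] EuclideanSpace ℂ (Finset (Orb (FermionTorus 2 L)))))
      c * (L : ℝ) ^ 4 * P.trace.re ≤
        (P * ((pairField dWaveFormFactor L)ᴴ * pairField dWaveFormFactor L)).trace.re) :
    let N : ℕ := 2 * ⌊(1 - δ) * (L : ℝ) ^ 2 / 2⌋₊
    let H := hubbardTorus 2 L 1 U
    let S := szSector (Λ := FermionTorus 2 L) N 0
    let E₀ := S ⊓ Module.End.eigenspace (Matrix.toLin' H) ((H.minEnergyOn S : ℝ) : ℂ)
    let P := projMatrix (E₀.map (Fock.toEuclidean (ι := Orb (FermionTorus 2 L)) :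
      Fock (Orb (FermionTorus 2 L)) →ₗ[ℂ] EuclideanSpace ℂ (Finset (Orb (FermionTorus 2 L)))))
    c ^ 2 * (L : ℝ) ^ 2 / 4096 ≤ ∑ k : TorusSite 2 L,
      (P * momentumNumber k 0).trace.re / P.trace.re *
        (1 - (P * momentumNumber k 0).trace.re / P.trace.re) := by
  intro N H S E₀ P
  have hup := re_trace_groundProj_mul_pairField_le_smearing L δ U
  have hP := one_le_re_trace_groundProj_hubbardTorus L 1 U δ hδ
  simp only at h hup hP ⊢
  set T := (projMatrix ((szSector (2 * ⌊(1 - δ) * (L : ℝ) ^ 2 / 2⌋₊) 0 ⊓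
      Module.End.eigenspace (Matrix.toLin' (hubbardTorus 2 L 1 U))
        (((hubbardTorus 2 L 1 U).minEnergyOn (szSector (2 * ⌊(1 - δ) * (L : ℝ) ^ 2 / 2⌋₊) 0) : ℝ) :
          ℂ)).map (Fock.toEuclidean (ι := Orb (FermionTorus 2 L)) :
      Fock (Orb (FermionTorus 2 L)) →ₗ[ℂ] EuclideanSpace ℂ (Finset (Orb (FermionTorus 2 L)))))).trace.re
    with hT
  set Sbar := ∑ k : TorusSite 2 L,
      (projMatrix ((szSector (2 * ⌊(1 - δ) * (L : ℝ) ^ 2 / 2⌋₊) 0 ⊓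
        Module.End.eigenspace (Matrix.toLin' (hubbardTorus 2 L 1 U))
          (((hubbardTorus 2 L 1 U).minEnergyOn (szSector (2 * ⌊(1 - δ) * (L : ℝ) ^ 2 / 2⌋₊) 0) : ℝ) :
            ℂ)).map (Fock.toEuclidean (ι := Orb (FermionTorus 2 L)) :
        Fock (Orb (FermionTorus 2 L)) →ₗ[ℂ] EuclideanSpace ℂ (Finset (Orb (FermionTorus 2 L))))) *
          momentumNumber k 0).trace.re / T *
        (1 - (projMatrix ((szSector (2 * ⌊(1 - δ) * (L : ℝ) ^ 2 / 2⌋₊) 0 ⊓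
          Module.End.eigenspace (Matrix.toLin' (hubbardTorus 2 L 1 U))
            (((hubbardTorus 2 L 1 U).minEnergyOn (szSector (2 * ⌊(1 - δ) * (L : ℝ) ^ 2 / 2⌋₊) 0) :
              ℝ) : ℂ)).map (Fock.toEuclidean (ι := Orb (FermionTorus 2 L)) :
          Fock (Orb (FermionTorus 2 L)) →ₗ[ℂ] EuclideanSpace ℂ (Finset (Orb (FermionTorus 2 L))))) *
            momentumNumber k 0).trace.re / T) with hSbar
  have hL0 : (0 : ℝ) < (L : ℝ) := by exact_mod_cast Nat.pos_of_ne_zero (NeZero.ne L)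
  have hT0 : 0 < T := by linarith
  -- `c L⁴ T ≤ T (32 L² + 32 L³ √Sbar)`, divide by `T > 0`
  have h1 : c * (L : ℝ) ^ 4 * T ≤ (32 * (L : ℝ) ^ 2 + 32 * (L : ℝ) ^ 3 * Real.sqrt Sbar) * T :=
    calc c * (L : ℝ) ^ 4 * T ≤ T * (32 * (L : ℝ) ^ 2 + 32 * (L : ℝ) ^ 3 * Real.sqrt Sbar) := h.trans hup
      _ = (32 * (L : ℝ) ^ 2 + 32 * (L : ℝ) ^ 3 * Real.sqrt Sbar) * T := mul_comm _ _
  exact smearing_ge_of_sqrt_bound hL0 h64 (le_of_mul_le_mul_right h1 hT0)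

/-- **Pointwise companion: SOME ground state is smeared.** Under the same single-datum average bound
(`δ ≥ -1`, `c L² ≥ 64`), some normalised ground state `ψ` of the sector `(2⌊(1-δ)L²/2⌋, S^z = 0)` of
`hubbardTorus 2 L 1 U` has `Σ_k x_k(ψ)(1 - x_k(ψ)) ≥ c² L²/4096`, `x_k(ψ) = Re ⟨ψ, n_{k↑} ψ⟩`
(`exists_groundState_le_of_trace_bound` and `smearing_ge_of_pairField_dWave_lro`). [folklore] -/
theorem exists_groundState_smearing_ge {δ U c : ℝ} (hδ : -1 ≤ δ) (h64 : 64 ≤ c * (L : ℝ) ^ 2)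
    (h : let N : ℕ := 2 * ⌊(1 - δ) * (L : ℝ) ^ 2 / 2⌋₊
      let H := hubbardTorus 2 L 1 U
      let S := szSector (Λ := FermionTorus 2 L) N 0
      let E₀ := S ⊓ Module.End.eigenspace (Matrix.toLin' H) ((H.minEnergyOn S : ℝ) : ℂ)
      let P := projMatrix (E₀.map (Fock.toEuclidean (ι := Orb (FermionTorus 2 L)) :
        Fock (Orb (FermionTorus 2 L)) →ₗ[ℂ] EuclideanSpace ℂ (Finset (Orb (FermionTorus 2 L)))))
      c * (L : ℝ) ^ 4 * P.trace.re ≤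
        (P * ((pairField dWaveFormFactor L)ᴴ * pairField dWaveFormFactor L)).trace.re) :
    ∃ ψ : Fock (Orb (FermionTorus 2 L)),
      IsGroundStateInSector (hubbardTorus 2 L 1 U) (2 * ⌊(1 - δ) * (L : ℝ) ^ 2 / 2⌋₊) 0 ψ ∧
        star ψ ⬝ᵥ ψ = 1 ∧
        c ^ 2 * (L : ℝ) ^ 2 / 4096 ≤ ∑ k : TorusSite 2 L,
          (star ψ ⬝ᵥ (momentumNumber k 0 *ᵥ ψ)).re * (1 - (star ψ ⬝ᵥ (momentumNumber k 0 *ᵥ ψ)).re) := by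
  obtain ⟨ψ, hgs, h1, hlro⟩ := exists_groundState_le_of_trace_bound L 1 U δ c hδ h
  exact ⟨ψ, hgs, h1, smearing_ge_of_pairField_dWave_lro ψ h1 h64 hlro⟩

/-- `64 ≤ c L²` once `L ≥ ⌈64/c⌉₊ + 1` (`c > 0`). [folklore] -/
theorem sixtyfour_le_mul_sq {c : ℝ} (hc : 0 < c) {L : ℕ} (hL : ⌈64 / c⌉₊ + 1 ≤ L) :
    64 ≤ c * (L : ℝ) ^ 2 := by
  have h1 : (64 / c : ℝ) ≤ ⌈64 / c⌉₊ := Nat.le_ceil _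
  have h2 : ((⌈64 / c⌉₊ + 1 : ℕ) : ℝ) ≤ (L : ℝ) := by exact_mod_cast hL
  push_cast at h2
  have hL1 : (1 : ℝ) ≤ (L : ℝ) := by
    have : (0 : ℝ) ≤ (⌈64 / c⌉₊ : ℝ) := Nat.cast_nonneg _
    linarith
  have hcL : 64 ≤ c * (L : ℝ) := by
    have h3 : 64 / c ≤ (L : ℝ) := by linarith
    rw [div_le_iff₀ hc] at h3
    linarith
  nlinarith

/-- **Every witness of the crux has a macroscopically smeared ground-state momentum distribution at
every coupling of its window.** If `(δ, U₁, U₂, c)` with `δ ∈ (0, 1/2)`, `c > 0` satisfies the crux's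
eventual average bound at every `U ∈ (U₁, U₂)`, then for every such `U`, eventually in even `L`,
`Σ_k x̄_k (1 - x̄_k) ≥ c² L²/4096` for `x̄_k = Re tr (P n_{k↑})/Re tr P` — no witness window inside a
regime of asymptotically sharp (`o(L²)`-smeared) ground-state momentum distributions.
Bardeen–Cooper–Schrieffer (1957) §II. [folklore] -/
theorem birGroundStateAverageLRO_witness_smearing {δ U₁ U₂ c : ℝ}
    (hδ : δ ∈ Set.Ioo (0:ℝ) (1/2)) (hc : 0 < c)
    (h : ∀ U ∈ Set.Ioo U₁ U₂, ∃ L₀ : ℕ, ∀ (L : ℕ) [NeZero L], L₀ ≤ L → Even L →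
      let N : ℕ := 2 * ⌊(1 - δ) * (L : ℝ) ^ 2 / 2⌋₊
      let H := hubbardTorus 2 L 1 U
      let S := szSector (Λ := FermionTorus 2 L) N 0
      let E₀ := S ⊓ Module.End.eigenspace (Matrix.toLin' H) ((H.minEnergyOn S : ℝ) : ℂ)
      let P := projMatrix (E₀.map (Fock.toEuclidean (ι := Orb (FermionTorus 2 L)) :
        Fock (Orb (FermionTorus 2 L)) →ₗ[ℂ] EuclideanSpace ℂ (Finset (Orb (FermionTorus 2 L)))))
      c * (L : ℝ) ^ 4 * P.trace.re ≤
        (P * ((pairField dWaveFormFactor L)ᴴ * pairField dWaveFormFactor L)).trace.re) :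
    ∀ U ∈ Set.Ioo U₁ U₂, ∃ L₀ : ℕ, ∀ (L : ℕ) [NeZero L], L₀ ≤ L → Even L →
      let N : ℕ := 2 * ⌊(1 - δ) * (L : ℝ) ^ 2 / 2⌋₊
      let H := hubbardTorus 2 L 1 U
      let S := szSector (Λ := FermionTorus 2 L) N 0
      let E₀ := S ⊓ Module.End.eigenspace (Matrix.toLin' H) ((H.minEnergyOn S : ℝ) : ℂ)
      let P := projMatrix (E₀.map (Fock.toEuclidean (ι := Orb (FermionTorus 2 L)) :
        Fock (Orb (FermionTorus 2 L)) →ₗ[ℂ] EuclideanSpace ℂ (Finset (Orb (FermionTorus 2 L)))))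
      c ^ 2 * (L : ℝ) ^ 2 / 4096 ≤ ∑ k : TorusSite 2 L,
        (P * momentumNumber k 0).trace.re / P.trace.re *
          (1 - (P * momentumNumber k 0).trace.re / P.trace.re) := by
  intro U hU
  obtain ⟨L₀, hL₀⟩ := h U hU
  refine ⟨max L₀ (⌈64 / c⌉₊ + 1), fun L _ hL hE => ?_⟩
  exact avgBound_smearing_ge L (by linarith [hδ.1]) (sixtyfour_le_mul_sq hc (le_of_max_le_right hL))
    (hL₀ L (le_of_max_le_left hL) hE)

/-- **Conditional reading for the route.** If `BirGroundStateAverageLRO` holds with data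
`(δ, U₁, U₂, c)`, then on the whole window, eventually in even `L`, the ground-state-averaged momentum
distribution of the sector ground states of `hubbardTorus 2 L 1 U` has total smearing
`≥ c² L²/4096` — the target EXCLUDES an asymptotically sharp Fermi surface on its window; one more
necessary condition any engine for the target must certify. [folklore] -/
theorem birGroundStateAverageLRO_smearing (h : BirGroundStateAverageLRO) :
    ∃ δ ∈ Set.Ioo (0:ℝ) (1/2), ∃ U₁ U₂ c : ℝ, 0 < U₁ ∧ U₁ < U₂ ∧ 0 < c ∧
      ∀ U ∈ Set.Ioo U₁ U₂, ∃ L₀ : ℕ, ∀ (L : ℕ) [NeZero L], L₀ ≤ L → Even L →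
        let N : ℕ := 2 * ⌊(1 - δ) * (L : ℝ) ^ 2 / 2⌋₊
        let H := hubbardTorus 2 L 1 U
        let S := szSector (Λ := FermionTorus 2 L) N 0
        let E₀ := S ⊓ Module.End.eigenspace (Matrix.toLin' H) ((H.minEnergyOn S : ℝ) : ℂ)
        let P := projMatrix (E₀.map (Fock.toEuclidean (ι := Orb (FermionTorus 2 L)) :
          Fock (Orb (FermionTorus 2 L)) →ₗ[ℂ] EuclideanSpace ℂ (Finset (Orb (FermionTorus 2 L)))))
        c ^ 2 * (L : ℝ) ^ 2 / 4096 ≤ ∑ k : TorusSite 2 L,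
          (P * momentumNumber k 0).trace.re / P.trace.re *
            (1 - (P * momentumNumber k 0).trace.re / P.trace.re) := by
  obtain ⟨δ, hδ, U₁, U₂, c, hU₁, hU, hc, hw⟩ := h
  exact ⟨δ, hδ, U₁, U₂, c, hU₁, hU, hc, birGroundStateAverageLRO_witness_smearing hδ hc hw⟩

/-! ### §4 The registered stub -/

/-- **Stub `momentumSmearingWitness`** (crux `BirGroundStateAverageLRO`, item 2079; prover seat 2): the
witness form `birGroundStateAverageLRO_witness_smearing` as registered — every witness `(δ, U₁, U₂, c)`
of the crux has, at every coupling of its window, eventually in even `L`, a ground-state-averaged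
momentum distribution with total smearing `Σ_k x̄_k(1 - x̄_k) ≥ c² L²/4096`. Bardeen–Cooper–Schrieffer
(1957) §II. [folklore] -/
theorem momentumSmearingWitness : ∀ (δ U₁ U₂ c : ℝ), δ ∈ Set.Ioo (0:ℝ) (1/2) → 0 < c → (∀ U ∈ Set.Ioo U₁ U₂, ∃ L₀ : ℕ, ∀ (L : ℕ) [NeZero L], L₀ ≤ L → Even L → (let N : ℕ := 2 * ⌊(1 - δ) * (L : ℝ) ^ 2 / 2⌋₊; let H := Literature.MathematicalPhysics.QuantumLattice.hubbardTorus 2 L 1 U; let S := Literature.MathematicalPhysics.QuantumLattice.szSector (Λ := Literature.MathematicalPhysics.QuantumLattice.FermionTorus 2 L) N 0; let E₀ := S ⊓ Module.End.eigenspace (Matrix.toLin' H) ((H.minEnergyOn S : ℝ) : ℂ); let P := Literature.MathematicalPhysics.QuantumLattice.projMatrix (E₀.map (Literature.MathematicalPhysics.QuantumLattice.Fock.toEuclidean (ι := Literature.MathematicalPhysics.QuantumLattice.Orb (Literature.MathematicalPhysics.QuantumLattice.FermionTorus 2 L)) : Literature.MathematicalPhysics.QuantumLattice.Fock (Literature.MathematicalPhysics.QuantumLattice.Orb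 (Literature.MathematicalPhysics.QuantumLattice.FermionTorus 2 L)) →ₗ[ℂ] EuclideanSpace ℂ (Finset (Literature.MathematicalPhysics.QuantumLattice.Orb (Literature.MathematicalPhysics.QuantumLattice.FermionTorus 2 L))))); c * (L : ℝ) ^ 4 * P.trace.re ≤ (P * (Matrix.conjTranspose (Literature.MathematicalPhysics.QuantumLattice.pairField Literature.MathematicalPhysics.QuantumLattice.dWaveFormFactor L) * Literature.MathematicalPhysics.QuantumLattice.pairField Literature.MathematicalPhysics.QuantumLattice.dWaveFormFactor L)).trace.re)) → ∀ U ∈ Set.Ioo U₁ U₂, ∃ L₀ : ℕ, ∀ (L : ℕ) [NeZero L], L₀ ≤ L → Even L → (let N : ℕ := 2 * ⌊(1 - δ) * (L : ℝ) ^ 2 / 2⌋₊; let H := Literature.MathematicalPhysics.QuantumLattice.hubbardTorus 2 L 1 U; let S := Literature.MathematicalPhysics.QuantumLattice.szSector (Λ := Literature.MathematicalPhysics.QuantumLattice.FermionTorus 2 L) N 0; let E₀ := S ⊓ Module.End.eigenspace (Matrix.toLin' H) ((H.minEnergyOn S : ℝ) : ℂ); let P := Literature.MathematicalPhysics.QuantumLattice.projMatrix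 (E₀.map (Literature.MathematicalPhysics.QuantumLattice.Fock.toEuclidean (ι := Literature.MathematicalPhysics.QuantumLattice.Orb (Literature.MathematicalPhysics.QuantumLattice.FermionTorus 2 L)) : Literature.MathematicalPhysics.QuantumLattice.Fock (Literature.MathematicalPhysics.QuantumLattice.Orb (Literature.MathematicalPhysics.QuantumLattice.FermionTorus 2 L)) →ₗ[ℂ] EuclideanSpace ℂ (Finset (Literature.MathematicalPhysics.QuantumLattice.Orb (Literature.MathematicalPhysics.QuantumLattice.FermionTorus 2 L))))); c ^ 2 * (L : ℝ) ^ 2 / 4096 ≤ ∑ k : Literature.Probability.LatticeModels.TorusSite 2 L, (P * Literature.MathematicalPhysics.QuantumLattice.momentumNumber k 0).trace.re / P.trace.re * (1 - (P * Literature.MathematicalPhysics.QuantumLattice.momentumNumber k 0).trace.re / P.trace.re)) :=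
  fun _ _ _ _ hδ hc h => birGroundStateAverageLRO_witness_smearing hδ hc h

end CruxFormat

end Summit.HubbardSuperconductivity.HubbardSuperconductivity.Theorems.BirGroundStateAverageLRO.Negative
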